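import Summits.CriticalPhenomena.PercolationContinuityZ3.Theorems.PercNearOneGluingNoHeavyLowerTailAntitheticCones
import HarnessLib

/-!
# `NoHeavyLowerTail` (stmt-CriticalPhenomena-4575) — antithetic cluster pairs: THEOREM I for R-LOCAL cones (prim-hp-2 gen 36,
# MEMO-gen36 §2)

Support file (`--supports stmt-CriticalPhenomena-4575`, hull-port prover `prim-hp-2`, gen 36).  No definitions, no named facts, no sorries;
standard axioms.

THEOREM I (`Antithetic.cone_bic_nonneg`, file `…AntitheticCones`) proves the bicluster-avoidance inequality BIC_G(R) ≥ 0 when the source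
`s` is adjacent to EVERY other vertex.  The cone hypothesis is used at one place only: two zones that share an edge must have spokes of the
same colour, which needs a spoke at every ZONE vertex.  A zone of `u ∈ R` lies inside the component of `u` in `G − s`, so it suffices that
`s` be adjacent to every vertex of every component of `G − s` that meets `R` ("R-local cone"); the other components of `G − s` are
arbitrary.  Since the functional `Δ = (F(red) − F(blue))(G(red) − G(blue))` does not factor over the components of `G − s`, this is a genuine
extension of THEOREM I (and it contains `bic_single_nonneg` only when the neighbour's component is fully joined to `s`).

* `Antithetic.Cone.spoke_iff_of_mem_zblock_local` — consistency of spoke colours on overlapping zone blocks under the local hypothesis;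
* `Antithetic.cone_local_bic_nonneg` — BIC_G(R) ≥ 0 for every `R ∌ s` such that every vertex `(G − s)`-reachable from `R` is adjacent to `s`.
[cite: VandenbergHaggstromKahn2005, §1 p. 6 ("Harris' inequality"), §1 p. 3 (open cluster `C_s`)]
-/

noncomputable section

namespace Summit.CriticalPhenomena.PercolationContinuityZ3.Theorems

open Literature.Probability.Percolation
open scoped Classical symmDiff

namespace Antithetic

namespace Cone

variable {V : Type*} {E : Set (Sym2 V)} {s : V} {R : Set V} {T : Set (Sym2 V)}

/-- A zone vertex is `(G − s)`-reachable from the zone's owner. [this work] -/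
theorem hReachable_of_mem_zone {u z : V} (hz : z ∈ zone E s T u) : (openGraph (hEdges E s)).Reachable u z :=
  (show (openGraph (oppConf E s T u)).Reachable u z from hz).mono (SimpleGraph.fromEdgeSet_mono fun _ he => he.2)

/-- **Consistency of spoke colours on overlapping blocks, R-local form**: if every vertex `(G − s)`-reachable from `R` is adjacent to `s`,
then in a constraint configuration two `R`-vertices whose zone blocks share an edge have spokes of the same colour. [this work] -/
theorem spoke_iff_of_mem_zblock_local (hloc : ∀ u ∈ R, ∀ x, (openGraph (hEdges E s)).Reachable u x → s(s, x) ∈ E) (hRs : s ∉ R)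
    (hT : ∀ r ∈ R, ¬ ((openGraph (T ∩ E)).Reachable s r ∧ (openGraph (Tᶜ ∩ E)).Reachable s r))
    {u v : V} (hu : u ∈ R) (hv : v ∈ R) {e : Sym2 V} (heu : e ∈ zblock E s T u) (hev : e ∈ zblock E s T v) :
    (s(s, u) ∈ T ↔ s(s, v) ∈ T) := by
  have hsp : ∀ w ∈ R, s(s, w) ∈ E := fun w hw => hloc w hw w (SimpleGraph.Reachable.refl w)
  have heE : e ∈ E := heu.1
  have A3 : ∀ w ∈ R, ∀ z ∈ zone E s T w, (s(s, z) ∈ T ↔ s(s, w) ∈ T) := fun w hw z hz =>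
    have hws : w ≠ s := fun h => hRs (h ▸ hw)
    spoke_iff_of_mem_zone hws (hsp w hw) (hT w hw) hz (hloc w hw z (hReachable_of_mem_zone hz))
  induction e using Sym2.ind with
  | h a b =>
    have A4 : ∀ w ∈ R, ¬ (a ∈ zone E s T w ∧ b ∈ zone E s T w) → (a ∈ zone E s T w ∨ b ∈ zone E s T w) →
        (s(a, b) ∈ T ↔ s(s, w) ∈ T) := by
      intro w hw hnot hor
      have hws : w ≠ s := fun h => hRs (h ▸ hw)
      rcases hor with ha | hb
      · have hb : b ∉ zone E s T w := fun hb => hnot ⟨ha, hb⟩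
        rw [Sym2.eq_swap]
        exact boundary_iff hws (hsp w hw) (hT w hw) hb ha (by rw [Sym2.eq_swap]; exact heE)
      · have ha : a ∉ zone E s T w := fun ha => hnot ⟨ha, hb⟩
        exact boundary_iff hws (hsp w hw) (hT w hw) ha hb heE
    have horu : a ∈ zone E s T u ∨ b ∈ zone E s T u := by
      obtain ⟨_, x, hx, hxe⟩ := heu
      rcases Sym2.mem_iff.1 hxe with rfl | rfl
      · exact Or.inl hx
      · exact Or.inr hx
    have horv : a ∈ zone E s T v ∨ b ∈ zone E s T v := by
      obtain ⟨_, x, hx, hxe⟩ := hev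
      rcases Sym2.mem_iff.1 hxe with rfl | rfl
      · exact Or.inl hx
      · exact Or.inr hx
    by_cases hbu : a ∈ zone E s T u ∧ b ∈ zone E s T u
    · by_cases hbv : a ∈ zone E s T v ∧ b ∈ zone E s T v
      · exact (A3 u hu a hbu.1).symm.trans (A3 v hv a hbv.1)
      · rcases horv with ha | hb
        · exact (A3 u hu a hbu.1).symm.trans (A3 v hv a ha)
        · exact (A3 u hu b hbu.2).symm.trans (A3 v hv b hb)
    · by_cases hbv : a ∈ zone E s T v ∧ b ∈ zone E s T v
      · rcases horu with ha | hb
        · exact (A3 u hu a ha).symm.trans (A3 v hv a hbv.1)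
        · exact (A3 u hu b hb).symm.trans (A3 v hv b hbv.2)
      · exact (A4 u hu hbu horu).symm.trans (A4 v hv hbv horv)

end Cone

section TheoremILocal

variable {V : Type*} [Fintype V]

/-- **THEOREM I, R-local form (prim-hp-2 gen 36): BIC on graphs whose `R`-components are fully joined to `s`.**  `E` an edge set on a finite
vertex type, `s` a source, `R ∌ s` such that every vertex reachable from a vertex of `R` along edges of `E` not containing `s` is adjacent to
`s`; `F, G` increasing in the edge cluster.  Then
`0 ≤ Σ_{ω : no r ∈ R is joined to s both in ω ∩ E and in ωᶜ ∩ E} (F(C_s(ω∩E)) − F(C_s(ωᶜ∩E))) · (G(C_s(ω∩E)) − G(C_s(ωᶜ∩E)))`.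
(Components of `G − s` not meeting `R` are arbitrary.) [this work] -/
theorem cone_local_bic_nonneg (E : Set (Sym2 V)) (s : V) (R : Set V) (hRs : s ∉ R)
    (hloc : ∀ u ∈ R, ∀ x, (openGraph {e | e ∈ E ∧ s ∉ e}).Reachable u x → s(s, x) ∈ E)
    {F G : Set (Sym2 V) → ℝ} (hF : Monotone F) (hG : Monotone G) :
    0 ≤ ∑ ω ∈ Finset.univ.filter (fun ω : Set (Sym2 V) =>
        ∀ r ∈ R, ¬ ((openGraph (ω ∩ E)).Reachable s r ∧ (openGraph (ωᶜ ∩ E)).Reachable s r)),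
      (F (openEdgeCluster (ω ∩ E) s) - F (openEdgeCluster (ωᶜ ∩ E) s)) *
        (G (openEdgeCluster (ω ∩ E) s) - G (openEdgeCluster (ωᶜ ∩ E) s)) := by
  have hRN : ∀ u ∈ R, s(s, u) ∈ E := fun u hu => hloc u hu u (SimpleGraph.Reachable.refl u)
  have hcons : ∀ T : Set (Sym2 V), (∀ r ∈ R, ¬ ((openGraph (T ∩ E)).Reachable s r ∧ (openGraph (Tᶜ ∩ E)).Reachable s r)) →
      ∀ u ∈ R, ∀ v ∈ R, ∀ e, e ∈ Cone.zblock E s T u → e ∈ Cone.zblock E s T v → (s(s, u) ∈ T ↔ s(s, v) ∈ T) :=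
    fun T hT u hu v hv e heu hev => Cone.spoke_iff_of_mem_zblock_local hloc hRs hT hu hv heu hev
  refine sum_nonneg_of_parts _ _ (Cone.zpart E s R) ?_ ?_ ?_ ?_
  · intro T hT
    rw [Finset.mem_filter] at hT
    exact Cone.mem_zpart_self (hcons T hT.2)
  · intro T hT M hM
    rw [Finset.mem_filter] at hT ⊢
    exact ⟨Finset.mem_univ _, Cone.mem_constraint_of_mem_zpart hRN hRs hT.2 (hcons T hT.2) hM⟩
  · intro T hT M hM
    rw [Finset.mem_filter] at hT
    exact Cone.zpart_eq_of_mem hRN (hcons T hT.2) hM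
  · intro T hT
    rw [Finset.mem_filter] at hT
    exact Cone.zpart_sum_nonneg hRN hRs hT.2 (hcons T hT.2) hF hG

end TheoremILocal

end Antithetic

end Summit.CriticalPhenomena.PercolationContinuityZ3.Theorems
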